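import Mathlib.Geometry.Manifold.BumpFunction
import Literature.Geometry.Kaehler.LocalFormsGlue
import Literature.NumberTheory.Transcendental.DolbeaultProofs
import Literature.NumberTheory.Transcendental.DolbeaultIntegrabilityProofs
import Literature.NumberTheory.Transcendental.DolbeaultLaplacianLocality
import Literature.NumberTheory.Transcendental.ComplexFormsSmoothProofs
import HarnessLib

/-!
# `(p,q)`-forms and `∂̄` on open subsets of a complex manifold (the Dolbeault complexes of the opens)

Companion of `Literature/Geometry/Kaehler/LocalForms.lean` (the de Rham complexes `Ω^•(U)` of the
open subsets of a manifold, realised inside `MForm I M F k` by extension by zero) for the Dolbeault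
complexes: for an open `W ⊆ M` of a complex manifold `M` modelled on `E`,

* `pqFormsOn W p q ⊆ MForm 𝓘(ℝ, E) M ℂ (p + q)` — the complex vector space `A^{p,q}(W)` of forms of
  type `(p,q)`, smooth at the points of `W`, zero off `W` (Voisin (2002), §2.3.1 for the whole
  manifold; Griffiths–Harris (1978), p. 25, "`A^{p,q}(U)`");
* `pqRestrict` — the restrictions `A^{p,q}(W) → A^{p,q}(W')` for open `W' ⊆ W`;
* `localDbar hW : A^{p,q}(W) → A^{p,q+1}(W)`, `α ↦ (∂̄α)|_W` — **the Dolbeault complex of `W`**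
  (Voisin (2002), §2.3.3; Griffiths–Harris (1978), p. 25): `ℂ`-linear (`dolbeaultBar_smul_holds`,
  additivity by localisation), `∂̄_W ∘ ∂̄_W = 0` (`localDbar_localDbar`, from the tree's
  `dolbeaultBar_dolbeaultBar_holds` on globally smooth forms), natural for restrictions
  (`localDbar_pqRestrict`), and equal to the tree's `dolbeaultBar` on `W = univ`;
* `IsDolbeaultAcyclic hW p` — `H^{p,q+1}_{∂̄}(W) = 0` for all `q` in this language (every
  `∂̄_W`-closed `(p,q+1)`-form on `W` is `∂̄_W` of a `(p,q)`-form on `W`), the hypothesis on the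
  finite intersections of a Leray cover in the Čech–Dolbeault comparison.

The one analytic device is **localisation by smooth bump functions** (`exists_smooth_eventuallyEq`:
a form smooth at the points of the open `W` agrees near each `x ∈ W` with a GLOBALLY smooth form
of the same type supported in `W`), which transports the tree's identities for globally smooth
forms (`dolbeaultBar_add`, `dolbeaultBar_dolbeaultBar_holds`) to `W` through the locality of `∂̄`
(`dolbeaultBar_congr_of_eventuallyEq`). Everything is proved; no named facts.

## References

* C. Voisin, *Hodge Theory and Complex Algebraic Geometry I* (2002), §2.3.1, §2.3.3 (Prop. 2.31,
  the Dolbeault complex). [cite: VoisinHodgeI2002, §2.3.3]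
* P. Griffiths, J. Harris, *Principles of Algebraic Geometry* (1978), pp. 23–25 (`A^{p,q}(U)`,
  `∂̄² = 0`, the Dolbeault cohomology of an open set). [GriffithsHarris1978]
-/

noncomputable section

open scoped Manifold ContDiff Topology
open Set Filter Function Literature.NumberTheory.Transcendental

namespace Literature.Geometry.Kaehler

variable {E : Type*} [NormedAddCommGroup E] [NormedSpace ℂ E]
  {M : Type*} [TopologicalSpace M] [ChartedSpace E M]

/-! ### Pointwise facts: types and restriction, complex scalars, function multiples -/

section Pointwise

variable {k : ℕ}

/-- Restriction to a subset preserves the type (pointwise the restriction is the form or `0`).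
[folklore] -/
theorem _root_.Literature.NumberTheory.Transcendental.IsOfType.restr {p q : ℕ}
    {α : MForm 𝓘(ℝ, E) M ℂ k} (hα : IsOfType p q α) (U : Set M) : IsOfType p q (α.restr U) := by
  refine ⟨hα.1, fun x θ v ↦ ?_⟩
  by_cases hx : x ∈ U
  · rw [MForm.restr_apply_of_mem _ hx, hα.2 x θ v]
  · simp [MForm.restr_apply_of_notMem _ hx]

/-- Multiplication by a real function preserves the type. [folklore] -/
theorem _root_.Literature.NumberTheory.Transcendental.IsOfType.fun_smul {p q : ℕ}
    {α : MForm 𝓘(ℝ, E) M ℂ k} (hα : IsOfType p q α) (ρ : M → ℝ) : IsOfType p q (ρ • α) :=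
  ⟨hα.1, fun x θ v ↦ by
    simp only [Pi.smul_apply', ContinuousAlternatingMap.smul_apply, hα.2 x θ v, Complex.real_smul]
    ring⟩

/-- Two forms that agree at a point have the same type behaviour there; in particular a form that
agrees near every point with forms of type `(p,q)` is of type `(p,q)` — recorded in the pointwise
form actually used: if `α x = β x` then the type identity of `β` at `x` transfers to `α`.
[folklore] -/
theorem _root_.Literature.NumberTheory.Transcendental.IsOfType.apply_rotate {p q : ℕ}
    {β : MForm 𝓘(ℝ, E) M ℂ k} (hβ : IsOfType p q β) (x : M) (θ : ℝ)
    (v : Fin k → TangentSpace 𝓘(ℝ, E) x) :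
    β x (fun i ↦ tangentRotate E x θ (v i)) = Complex.exp (((p : ℤ) - q : ℤ) * θ * Complex.I) * β x v :=
  hβ.2 x θ v

/-- Restriction commutes with complex scalars. [folklore] -/
theorem MForm.restr_smul_complex (U : Set M) (c : ℂ) (α : MForm 𝓘(ℝ, E) M ℂ k) :
    (c • α).restr U = c • α.restr U := by
  funext x
  by_cases hx : x ∈ U
  · rw [MForm.restr_apply_of_mem _ hx, Pi.smul_apply, Pi.smul_apply, MForm.restr_apply_of_mem _ hx]
  · rw [MForm.restr_apply_of_notMem _ hx, Pi.smul_apply, MForm.restr_apply_of_notMem _ hx, smul_zero]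

/-- Smoothness at a point is preserved by complex scalars (a private copy of
`MForm.SmoothAt.smul_complex` of `ChernCharacterProofs`, to keep the import closure small).
[folklore] -/
private theorem smoothAt_smul_complex (c : ℂ) {α : MForm 𝓘(ℝ, E) M ℂ k} {x : M} (hα : α.SmoothAt x) :
    (c • α).SmoothAt x := by
  rw [MForm.SmoothAt, MForm.inChart_smul_complex]
  exact ContDiffWithinAt.const_smul c hα

end Pointwise

/-! ### `(p,q)`-forms on an open set -/

section PQ

variable (E M) in
/-- **The `(p,q)`-forms on a subset `W ⊆ M`**, `A^{p,q}(W)`: forms of type `(p,q)` on `M`, smooth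
at every point of `W` and vanishing off `W` (for `W` open: the smooth `(p,q)`-forms on the open
submanifold `W`, realised inside `MForm 𝓘(ℝ, E) M ℂ (p + q)` by extension by zero, exactly as
`smoothFormsOn` realises `Ωᵏ(W)`). Voisin (2002), §2.3.1; Griffiths–Harris (1978), p. 25.
[cite: VoisinHodgeI2002, §2.3.1] -/
def pqFormsOn (W : Set M) (p q : ℕ) : Submodule ℂ (MForm 𝓘(ℝ, E) M ℂ (p + q)) where
  carrier := {α | (∀ x ∈ W, α.SmoothAt x) ∧ (∀ x ∉ W, α x = 0) ∧ IsOfType p q α}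
  add_mem' hα hβ := ⟨fun x hx ↦ (hα.1 x hx).add (hβ.1 x hx),
    fun x hx ↦ by rw [Pi.add_apply, hα.2.1 x hx, hβ.2.1 x hx, add_zero], hα.2.2.add hβ.2.2⟩
  zero_mem' := ⟨fun x _ ↦ MForm.smoothAt_zero x, fun _ _ ↦ rfl, isOfType_zero rfl⟩
  smul_mem' c _ hα := ⟨fun x hx ↦ smoothAt_smul_complex c (hα.1 x hx),
    fun x hx ↦ by rw [Pi.smul_apply, hα.2.1 x hx, smul_zero], hα.2.2.smul c⟩

variable {W W' : Set M} {p q : ℕ}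

/-- Membership in `pqFormsOn`. [folklore] -/
theorem mem_pqFormsOn_iff {α : MForm 𝓘(ℝ, E) M ℂ (p + q)} :
    α ∈ pqFormsOn E M W p q ↔ (∀ x ∈ W, α.SmoothAt x) ∧ (∀ x ∉ W, α x = 0) ∧ IsOfType p q α :=
  Iff.rfl

/-- A `(p,q)`-form on `W` is a form on `W` in the sense of `LocalForms`. [folklore] -/
theorem mem_smoothFormsOn_of_mem_pqFormsOn {α : MForm 𝓘(ℝ, E) M ℂ (p + q)}
    (hα : α ∈ pqFormsOn E M W p q) : α ∈ smoothFormsOn 𝓘(ℝ, E) ℂ W (p + q) :=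
  ⟨hα.1, hα.2.1⟩

/-- A `(p,q)`-form on `W` is its own restriction to `W`. [folklore] -/
theorem restr_eq_self_of_mem_pqFormsOn {α : MForm 𝓘(ℝ, E) M ℂ (p + q)}
    (hα : α ∈ pqFormsOn E M W p q) : α.restr W = α :=
  MForm.restr_eq_self hα.2.1

/-- A `(p,q)`-form on an open `W` is smooth near each point of `W`. [folklore] -/
theorem eventually_smoothAt_of_mem_pqFormsOn (hW : IsOpen W) {α : MForm 𝓘(ℝ, E) M ℂ (p + q)}
    (hα : α ∈ pqFormsOn E M W p q) {x : M} (hx : x ∈ W) : ∀ᶠ z in 𝓝 x, α.SmoothAt z :=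
  eventually_smoothAt_of_mem hW (mem_smoothFormsOn_of_mem_pqFormsOn hα) hx

/-- On `W = univ` the `(p,q)`-forms are the smooth `(p,q)`-forms of the tree (`pqForms`).
[cite: VoisinHodgeI2002, §2.3.1] -/
theorem mem_pqFormsOn_univ_iff {α : MForm 𝓘(ℝ, E) M ℂ (p + q)} :
    α ∈ pqFormsOn E M (univ : Set M) p q ↔ α ∈ pqForms E M p q := by
  rw [mem_pqForms_iff, mem_pqFormsOn_iff, isSmoothForm_iff_smoothAt]
  exact ⟨fun h ↦ ⟨fun x ↦ h.1 x (mem_univ x), h.2.2⟩, fun h ↦ ⟨fun x _ ↦ h.1 x, fun x hx ↦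
    (hx (mem_univ x)).elim, h.2⟩⟩

/-- **Restriction to a smaller open set** maps `A^{p,q}(W)` to `A^{p,q}(W')` for open `W' ⊆ W`.
[cite: VoisinHodgeI2002, §2.3.1] -/
theorem restr_mem_pqFormsOn (hW' : IsOpen W') (h : W' ⊆ W) {α : MForm 𝓘(ℝ, E) M ℂ (p + q)}
    (hα : α ∈ pqFormsOn E M W p q) : α.restr W' ∈ pqFormsOn E M W' p q :=
  ⟨(restr_mem_smoothFormsOn hW' h (mem_smoothFormsOn_of_mem_pqFormsOn hα)).1,
    fun _ hx ↦ MForm.restr_apply_of_notMem _ hx, hα.2.2.restr W'⟩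

variable (E M) in
/-- The restriction `A^{p,q}(W) → A^{p,q}(W')` for open `W' ⊆ W`, as a `ℂ`-linear map.
[cite: VoisinHodgeI2002, §2.3.1] -/
def pqRestrict (hW' : IsOpen W') (h : W' ⊆ W) (p q : ℕ) :
    ↥(pqFormsOn E M W p q) →ₗ[ℂ] ↥(pqFormsOn E M W' p q) where
  toFun α := ⟨(α : MForm 𝓘(ℝ, E) M ℂ (p + q)).restr W', restr_mem_pqFormsOn hW' h α.2⟩
  map_add' _ _ := Subtype.ext (MForm.restr_add W' _ _)
  map_smul' c _ := Subtype.ext (MForm.restr_smul_complex W' c _)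

/-- Underlying form of a restriction. [folklore] -/
@[simp]
theorem coe_pqRestrict (hW' : IsOpen W') (h : W' ⊆ W) (α : ↥(pqFormsOn E M W p q)) :
    (pqRestrict E M hW' h p q α : MForm 𝓘(ℝ, E) M ℂ (p + q)) = (α : MForm 𝓘(ℝ, E) M ℂ (p + q)).restr W' :=
  rfl

end PQ

/-! ### Localisation by bump functions -/

section Localise

variable [FiniteDimensional ℂ E] [T2Space M] [IsManifold 𝓘(ℝ, E) ∞ M] {W : Set M} {p q : ℕ}

/-- **Localisation.** A form which is smooth at the points of an open `W` and of type `(p,q)`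
agrees near each `x ∈ W` with a GLOBALLY smooth form of type `(p,q)` (namely `f • α` for a smooth
bump function `f` equal to `1` near `x` with `tsupport f ⊆ W`). [folklore] -/
theorem exists_smooth_eventuallyEq (hW : IsOpen W) {α : MForm 𝓘(ℝ, E) M ℂ (p + q)}
    (hα : α ∈ pqFormsOn E M W p q) {x : M} (hx : x ∈ W) :
    ∃ β : MForm 𝓘(ℝ, E) M ℂ (p + q), IsSmoothForm β ∧ IsOfType p q β ∧ ∀ᶠ z in 𝓝 x, β z = α z := by
  obtain ⟨f, -, hf⟩ := (SmoothBumpFunction.nhds_basis_tsupport (I := 𝓘(ℝ, E)) x).mem_iff.1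
    (hW.mem_nhds hx)
  refine ⟨(f : M → ℝ) • α, ?_, hα.2.2.fun_smul f, ?_⟩
  · refine (isSmoothForm_iff_smoothAt _).2 fun z ↦ ?_
    by_cases hz : z ∈ W
    · exact (hα.1 z hz).fun_smul f.contMDiff.contMDiffAt
    · -- off `W` the product vanishes near `z`
      have h0 : (f : M → ℝ) =ᶠ[𝓝 z] 0 := notMem_tsupport_iff_eventuallyEq.1 fun h ↦ hz (hf h)
      refine MForm.smoothAt_of_eventuallyEq_zero ?_
      filter_upwards [h0] with w hw
      rw [Pi.smul_apply', hw, Pi.zero_apply, zero_smul]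
  · filter_upwards [f.eventuallyEq_one] with z hz
    rw [Pi.smul_apply', hz, Pi.one_apply, one_smul]

end Localise

/-! ### The operator `∂̄` of an open set -/

section Dbar

variable [FiniteDimensional ℂ E] [T2Space M] [IsManifold 𝓘(ℂ, E) ω M] [IsManifold 𝓘(ℝ, E) ∞ M]
  {W W' : Set M} {p q : ℕ}

/-- **`∂̄` of a `(p,q)`-form on an open `W` is smooth at the points of `W`** (localise to a
globally smooth form and use the tree's `isSmoothForm_dolbeaultBar`). [cite: VoisinHodgeI2002, §2.3.3] -/
theorem smoothAt_dolbeaultBar_of_mem_pqFormsOn (hW : IsOpen W) {α : MForm 𝓘(ℝ, E) M ℂ (p + q)}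
    (hα : α ∈ pqFormsOn E M W p q) {x : M} (hx : x ∈ W) : (dolbeaultBar α).SmoothAt x := by
  obtain ⟨β, hβs, -, hβα⟩ := exists_smooth_eventuallyEq hW hα hx
  have hsm : IsSmoothForm (dolbeaultBar β) :=
    isSmoothForm_dolbeaultBar isSmoothForm_typeComponent_holds (fun hγ ↦ hγ.mextDeriv) hβs
  exact MForm.SmoothAt.congr_of_eventuallyEq ((isSmoothForm_iff_smoothAt _).1 hsm x)
    (dolbeaultBar_eventuallyEq_of_eventuallyEq hβα)

/-- `(∂̄α)|_W ∈ A^{p,q+1}(W)` for `α ∈ A^{p,q}(W)`. [cite: VoisinHodgeI2002, §2.3.3] -/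
theorem restr_dolbeaultBar_mem_pqFormsOn (hW : IsOpen W) {α : MForm 𝓘(ℝ, E) M ℂ (p + q)}
    (hα : α ∈ pqFormsOn E M W p q) : (dolbeaultBar α).restr W ∈ pqFormsOn E M W p (q + 1) :=
  ⟨fun _ hx ↦ (MForm.smoothAt_restr_iff hW _ hx).2 (smoothAt_dolbeaultBar_of_mem_pqFormsOn hW hα hx),
    fun _ hx ↦ MForm.restr_apply_of_notMem _ hx, (IsOfType.dolbeaultBar_holds hα.2.2).restr W⟩

/-- **Additivity of `∂̄` at the points of `W`** for forms on `W` (localise both forms and use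
`dolbeaultBar_add` for globally smooth forms). [cite: VoisinHodgeI2002, §2.3.3] -/
theorem dolbeaultBar_add_apply_of_mem (hW : IsOpen W) {α β : MForm 𝓘(ℝ, E) M ℂ (p + q)}
    (hα : α ∈ pqFormsOn E M W p q) (hβ : β ∈ pqFormsOn E M W p q) {x : M} (hx : x ∈ W) :
    dolbeaultBar (α + β) x = dolbeaultBar α x + dolbeaultBar β x := by
  obtain ⟨α', hα's, -, hα'⟩ := exists_smooth_eventuallyEq hW hα hx
  obtain ⟨β', hβ's, -, hβ'⟩ := exists_smooth_eventuallyEq hW hβ hx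
  have hsum : ∀ᶠ z in 𝓝 x, (α' + β') z = (α + β) z := by
    filter_upwards [hα', hβ'] with z hz hz'
    rw [Pi.add_apply, Pi.add_apply, hz, hz']
  rw [← dolbeaultBar_congr_of_eventuallyEq hsum,
    dolbeaultBar_add isSmoothForm_typeComponent_holds hα's hβ's, Pi.add_apply,
    dolbeaultBar_congr_of_eventuallyEq hα', dolbeaultBar_congr_of_eventuallyEq hβ']

variable (E M) in
/-- **The Dolbeault operator of the open set `W`**: `∂̄_W α = (∂̄α)|_W` on `A^{p,q}(W)`
(Voisin (2002), §2.3.3, Prop. 2.31 and the Dolbeault complex `(A^{p,•}(W), ∂̄)`;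
Griffiths–Harris (1978), p. 25). [cite: VoisinHodgeI2002, §2.3.3] -/
def localDbar (hW : IsOpen W) (p q : ℕ) : ↥(pqFormsOn E M W p q) →ₗ[ℂ] ↥(pqFormsOn E M W p (q + 1)) where
  toFun α := ⟨(dolbeaultBar (α : MForm 𝓘(ℝ, E) M ℂ (p + q))).restr W,
    restr_dolbeaultBar_mem_pqFormsOn hW α.2⟩
  map_add' α β := by
    refine Subtype.ext (funext fun x ↦ ?_)
    by_cases hx : x ∈ W
    · simp only [Submodule.coe_add, MForm.restr_apply_of_mem _ hx, Pi.add_apply]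
      exact dolbeaultBar_add_apply_of_mem hW α.2 β.2 hx
    · simp only [Submodule.coe_add, MForm.restr_apply_of_notMem _ hx, Pi.add_apply, add_zero]
  map_smul' c α := by
    refine Subtype.ext ?_
    simp only [Submodule.coe_smul, RingHom.id_apply]
    rw [dolbeaultBar_smul_holds c, MForm.restr_smul_complex]

/-- Underlying form of `∂̄_W α`. [folklore] -/
@[simp]
theorem coe_localDbar (hW : IsOpen W) (α : ↥(pqFormsOn E M W p q)) :
    (localDbar E M hW p q α : MForm 𝓘(ℝ, E) M ℂ (p + (q + 1))) =
      (dolbeaultBar (α : MForm 𝓘(ℝ, E) M ℂ (p + q))).restr W :=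
  rfl

/-- At a point of `W`, `∂̄_W α` is `∂̄α`. [folklore] -/
theorem localDbar_apply_of_mem (hW : IsOpen W) (α : ↥(pqFormsOn E M W p q)) {x : M} (hx : x ∈ W) :
    (localDbar E M hW p q α : MForm 𝓘(ℝ, E) M ℂ (p + (q + 1))) x =
      dolbeaultBar (α : MForm 𝓘(ℝ, E) M ℂ (p + q)) x :=
  MForm.restr_apply_of_mem _ hx

/-- **`∂̄_W ∘ ∂̄_W = 0`** (from `∂̄² = 0` for globally smooth forms, `dolbeaultBar_dolbeaultBar_holds`,
by localisation and the locality of `∂̄`). Voisin (2002), §2.3.3; Griffiths–Harris (1978), p. 25.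
[cite: VoisinHodgeI2002, §2.3.3] -/
theorem localDbar_localDbar (hW : IsOpen W) (α : ↥(pqFormsOn E M W p q)) :
    localDbar E M hW p (q + 1) (localDbar E M hW p q α) = 0 := by
  refine Subtype.ext (funext fun x ↦ ?_)
  rw [coe_localDbar, ZeroMemClass.coe_zero, Pi.zero_apply]
  by_cases hx : x ∈ W
  · rw [MForm.restr_apply_of_mem _ hx, coe_localDbar]
    obtain ⟨β, hβs, -, hβα⟩ := exists_smooth_eventuallyEq hW α.2 hx
    -- near `x`, `(∂̄α)|_W = ∂̄α = ∂̄β`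
    have h1 : ∀ᶠ z in 𝓝 x, (dolbeaultBar (α : MForm 𝓘(ℝ, E) M ℂ (p + q))).restr W z =
        dolbeaultBar β z := by
      filter_upwards [MForm.restr_eventuallyEq hW (dolbeaultBar (α : MForm 𝓘(ℝ, E) M ℂ (p + q))) hx,
        dolbeaultBar_eventuallyEq_of_eventuallyEq hβα] with z hz hz'
      rw [hz, hz']
    rw [dolbeaultBar_congr_of_eventuallyEq h1, dolbeaultBar_dolbeaultBar_holds hβs]
    rfl
  · rw [MForm.restr_apply_of_notMem _ hx]

/-- **`∂̄` commutes with restriction**: `∂̄_{W'} (α|_{W'}) = (∂̄_W α)|_{W'}` for open `W' ⊆ W`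
(locality of `∂̄`). [cite: VoisinHodgeI2002, §2.3.3] -/
theorem localDbar_pqRestrict (hW : IsOpen W) (hW' : IsOpen W') (h : W' ⊆ W)
    (α : ↥(pqFormsOn E M W p q)) :
    localDbar E M hW' p q (pqRestrict E M hW' h p q α) =
      pqRestrict E M hW' h p (q + 1) (localDbar E M hW p q α) := by
  refine Subtype.ext (funext fun x ↦ ?_)
  rw [coe_localDbar, coe_pqRestrict, coe_pqRestrict, coe_localDbar]
  by_cases hx : x ∈ W'
  · rw [MForm.restr_apply_of_mem _ hx, MForm.restr_apply_of_mem _ hx,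
      MForm.restr_apply_of_mem _ (h hx)]
    exact dolbeaultBar_congr_of_eventuallyEq (MForm.restr_eventuallyEq hW' _ hx)
  · rw [MForm.restr_apply_of_notMem _ hx, MForm.restr_apply_of_notMem _ hx]

/-- On `W = univ`, `∂̄_univ` is the tree's `∂̄`. [cite: VoisinHodgeI2002, §2.3.3] -/
theorem coe_localDbar_univ (α : ↥(pqFormsOn E M (univ : Set M) p q)) :
    (localDbar E M isOpen_univ p q α : MForm 𝓘(ℝ, E) M ℂ (p + (q + 1))) =
      dolbeaultBar (α : MForm 𝓘(ℝ, E) M ℂ (p + q)) :=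
  MForm.restr_univ _

omit [FiniteDimensional ℂ E] [T2Space M] in
/-- The `∂̄`-exact `(p,q+1)`-forms of the tree are the range of `∂̄` on the smooth `(p,q)`-forms
(the span in `dolbeaultExactForms` adds nothing, `∂̄` being `ℂ`-linear there; restated here to keep
the import closure small). [cite: VoisinHodgeI2002, §2.3.3] -/
theorem mem_dolbeaultExactForms_succ_iff {α : MForm 𝓘(ℝ, E) M ℂ (p + (q + 1))} :
    α ∈ dolbeaultExactForms E M p (q + 1) ↔ ∃ β ∈ pqForms E M p q, dolbeaultBar β = α := by
  -- the image of the `ℂ`-submodule `pqForms` under the `ℂ`-linear `∂̄` is a submodule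
  let S : Submodule ℂ (MForm 𝓘(ℝ, E) M ℂ (p + (q + 1))) :=
    { carrier := {α | ∃ β ∈ pqForms E M p q, dolbeaultBar β = α}
      add_mem' := by
        rintro _ _ ⟨β, hβ, rfl⟩ ⟨γ, hγ, rfl⟩
        refine ⟨β + γ, Submodule.add_mem _ hβ hγ, ?_⟩
        exact dolbeaultBar_add isSmoothForm_typeComponent_holds ((mem_pqForms_iff _).1 hβ).1
          ((mem_pqForms_iff _).1 hγ).1
      zero_mem' := ⟨0, Submodule.zero_mem _, dolbeaultBar_zero⟩
      smul_mem' := by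
        rintro c _ ⟨β, hβ, rfl⟩
        exact ⟨c • β, Submodule.smul_mem _ c hβ, dolbeaultBar_smul_holds c β⟩ }
  have hS : dolbeaultExactForms E M p (q + 1) = S := by
    refine le_antisymm (Submodule.span_le.2 ?_) ?_
    · rintro _ ⟨β, hβ, rfl⟩
      exact ⟨β, hβ, rfl⟩
    · rintro α ⟨β, hβ, rfl⟩
      exact Submodule.subset_span ⟨β, hβ, rfl⟩
  rw [hS]
  rfl

variable (E M) in
/-- **Dolbeault-acyclicity of an open set in bidegrees `(p, ≥ 1)`**: every `∂̄_W`-closed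
`(p,q+1)`-form on `W` is `∂̄_W` of a `(p,q)`-form on `W`, for all `q` — `H^{p,q}_{∂̄}(W) = 0` for
`q ≥ 1` (for polydiscs and convex opens this is the `∂̄`-Poincaré lemma, Voisin (2002),
Prop. 2.36; Griffiths–Harris (1978), p. 25). A hypothesis schema, not a statement.
[cite: VoisinHodgeI2002, Prop. 2.36] -/
def IsDolbeaultAcyclic (hW : IsOpen W) (p : ℕ) : Prop :=
  ∀ (q : ℕ) (α : ↥(pqFormsOn E M W p (q + 1))), localDbar E M hW p (q + 1) α = 0 →
    ∃ β : ↥(pqFormsOn E M W p q), localDbar E M hW p q β = α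

end Dbar

end Literature.Geometry.Kaehler

end
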